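import Summits.CriticalPhenomena.CardyFormulaZ2.Theorems.CardyBondTriangularBondTriangularCardyKiteDomain
import HarnessLib

/-!
# Route CardyBondTriangular · crux `BondTriangularCardy` · line `birth`: the kite-interface toolkit, IV — the crossing invariants

Helper of the stub `stub_clDuality`. The invariants carried along the followed interface
(Bollobás–Riordan, *Percolation* (2006), Ch. 7, proof of Lemma 5, p. 170: "the black hexagons on
the right of `P` form a connected subgraph … joining `A₁⁺` to `A₃⁺`"), for the Chayes–Lei hexagon
model with half-edge connectivity on a 4-marked discrete domain `D`:

* the yellow side `py D σ` of a kite `(x, k)`: an inside hexagon `x` is the end of a **yellow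
  chain from the stretch `0`** (`yPath`: a `𝕋`-walk of hexagons of the domain, none pure blue,
  consecutive ones yellow-adjacent in `clYellowGraph σ`, starting at the tail of a dart of the
  stretch `0` towards which it shows yellow, `YellowTowards`); an outside kite lies beyond a dart
  of the stretch `0`;
* the blue side `pb D σ`: dually, a **blue chain to the stretch `3`** (`bPath`), or an outside kite
  beyond the stretch `3`;
* the two conclusions `yCross D` (a yellow chain from the stretch `0` to the stretch `2`) and
  `bCross D` (a blue chain from the stretch `1` to the stretch `3`) — literally the two disjuncts
  of the duality lemma `Sig.stub_clDuality`.

Main results: the transfer of the yellow invariant along two yellow kites of adjacent hexagons at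
a common corner (`py_step`: extend the chain by a yellow half-edge adjacency, or read off a
yellow crossing when the chain reaches a dart of the stretch `2`), its blue twin (`pb_step`), and
the one-step preservation of both invariants along the interface (`inv_succ`), by the nine
transitions of `succ`.

References: Bollobás–Riordan 2006 Ch. 7 Lemma 5 pp. 169–171; Chayes–Lei 2007 §2.1–2.3.
-/

namespace Summit.CriticalPhenomena.CardyFormulaZ2.Theorems.BondTriangularCardyLine.Kite

open Literature.Probability.Percolation Literature.Probability.LatticeModels

variable (D : TriMarkedDomain 4) (σ : CLHexConfig)

/-! ### The invariants -/

/-- **Hexagons at the end of a yellow chain from the stretch `0`.** -/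
def yPath : Set (Site 2) :=
  {h | ∃ du ∈ D.stretch 0, YellowTowards σ du ∧ ∃ P : triGraph.Walk du.1 h,
    (∀ x ∈ P.support, x ∈ D.verts ∧ σ x ≠ CLHexState.B) ∧ ∀ e ∈ P.darts, (clYellowGraph σ).Adj e.fst e.snd}

/-- **Hexagons at the start of a blue chain to the stretch `3`.** -/
def bPath : Set (Site 2) :=
  {h | ∃ dv ∈ D.stretch 3, BlueTowards σ dv ∧ ∃ P : triGraph.Walk h dv.1,
    (∀ x ∈ P.support, x ∈ D.verts ∧ σ x ≠ CLHexState.Y) ∧ ∀ e ∈ P.darts, (clBlueGraph σ).Adj e.fst e.snd}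

/-- **The yellow-side invariant of a kite**: inside, its hexagon ends a yellow chain from the
stretch `0`; outside, it lies beyond a dart of the stretch `0`. -/
def py : Set (Site 2 × Fin 6) := {p | (p.1 ∈ D.verts ∧ p.1 ∈ yPath D σ) ∨ (p.1 ∉ D.verts ∧ ksidx D p.1 p.2 = 0)}

/-- **The blue-side invariant of a kite.** -/
def pb : Set (Site 2 × Fin 6) := {p | (p.1 ∈ D.verts ∧ p.1 ∈ bPath D σ) ∨ (p.1 ∉ D.verts ∧ ksidx D p.1 p.2 = 3)}

/-- **A yellow crossing from the stretch `0` to the stretch `2`** (first disjunct of the duality lemma). -/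
def yCross : Set CLHexConfig :=
  {σ | ∃ (du dv : Site 2 × Site 2) (P : triGraph.Walk du.1 dv.1), du ∈ D.stretch 0 ∧ dv ∈ D.stretch 2 ∧
    YellowTowards σ du ∧ YellowTowards σ dv ∧ (∀ x ∈ P.support, x ∈ D.verts ∧ σ x ≠ CLHexState.B) ∧
    ∀ d ∈ P.darts, (clYellowGraph σ).Adj d.fst d.snd}

/-- **A blue crossing from the stretch `1` to the stretch `3`** (second disjunct). -/
def bCross : Set CLHexConfig :=
  {σ | ∃ (du dv : Site 2 × Site 2) (P : triGraph.Walk du.1 dv.1), du ∈ D.stretch 1 ∧ dv ∈ D.stretch 3 ∧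
    BlueTowards σ du ∧ BlueTowards σ dv ∧ (∀ x ∈ P.support, x ∈ D.verts ∧ σ x ≠ CLHexState.Y) ∧
    ∀ d ∈ P.darts, (clBlueGraph σ).Adj d.fst d.snd}

/-- **The invariant of a dart**: yellow side on the right, blue side on the left, unless done. -/
def inv : Set Dart :=
  {d | (d.R ∈ py D σ ∨ σ ∈ yCross D ∪ bCross D) ∧ (d.L ∈ pb D σ ∨ σ ∈ yCross D ∪ bCross D)}

variable {D σ}

/-! ### Boundary darts and stretches -/

/-- A boundary dart lies in the stretch of its position. -/
theorem mem_stretch_stretchIdx {d : Site 2 × Site 2} (hd : d ∈ triBdryDarts D.verts) :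
    d ∈ D.stretch (D.stretchIdx (D.dpos d)) := by
  have := D.iter_mem_stretch (D.dpos d)
  rwa [D.iter_dpos hd] at this

/-- Yellow half-edge adjacency from two yellow kites at a common corner. -/
theorem clYellow_adj_of_kc {x x' : Site 2} {k₁ k₂ : Fin 6} (hadj : triGraph.Adj x x') (hF : leftFaceDir x k₁ = leftFaceDir x' k₂)
    (hx : x ∈ D.verts) (hx' : x' ∈ D.verts) (h₁ : kc D σ x k₁ = true) (h₂ : kc D σ x' k₂ = true) :
    (clYellowGraph σ).Adj x x' :=
  (clYellowGraph_adj_iff σ x x').2 ⟨hadj, leftFaceDir x k₁, mem_hexFaceVertices_leftFaceDir_self x k₁, hF ▸ mem_hexFaceVertices_leftFaceDir_self x' k₂,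
    yellowAt_of_kc hx h₁, hF ▸ yellowAt_of_kc hx' h₂⟩

/-- **Registered anchor of this file** (`kite_clYellow_adj_of_kc`): two inside hexagons with yellow
kites at a common corner are adjacent in `clYellowGraph σ` (Chayes–Lei's half-edge connectivity). -/
theorem kite_clYellow_adj_of_kc : ∀ (D : Literature.Probability.Percolation.TriMarkedDomain 4) (σ : Literature.Probability.Percolation.CLHexConfig) (x x' : Literature.Probability.LatticeModels.Site 2) (k₁ k₂ : Fin 6), Literature.Probability.LatticeModels.triGraph.Adj x x' → Literature.Probability.Percolation.leftFaceDir x k₁ = Literature.Probability.Percolation.leftFaceDir x' k₂ → x ∈ D.verts → x' ∈ D.verts → Summit.CriticalPhenomena.CardyFormulaZ2.Theorems.BondTriangularCardyLine.Kite.kc D σ x k₁ = true → Summit.CriticalPhenomena.CardyFormulaZ2.Theorems.BondTriangularCardyLine.Kite.kc D σ x' k₂ = true → (Literature.Probability.Percolation.clYellowGraph σ).Adj x x' :=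
  fun _ _ _ _ _ _ hadj hF hx hx' h₁ h₂ => clYellow_adj_of_kc hadj hF hx hx' h₁ h₂

/-- Blue half-edge adjacency from two blue kites at a common corner. -/
theorem clBlue_adj_of_kc {x x' : Site 2} {k₁ k₂ : Fin 6} (hadj : triGraph.Adj x x') (hF : leftFaceDir x k₁ = leftFaceDir x' k₂)
    (hx : x ∈ D.verts) (hx' : x' ∈ D.verts) (h₁ : kc D σ x k₁ = false) (h₂ : kc D σ x' k₂ = false) :
    (clBlueGraph σ).Adj x x' :=
  (clBlueGraph_adj_iff σ x x').2 ⟨hadj, leftFaceDir x k₁, mem_hexFaceVertices_leftFaceDir_self x k₁, hF ▸ mem_hexFaceVertices_leftFaceDir_self x' k₂,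
    not_yellowAt_of_kc hx h₁, hF ▸ not_yellowAt_of_kc hx' h₂⟩

/-- Two outside kites of the same colour at a corner touching the domain see the same stretch. -/
theorem ksidx_eq_of_outside {x x' : Site 2} {k₁ k₂ : Fin 6} (hF : leftFaceDir x k₁ = leftFaceDir x' k₂) (hne : x ≠ x')
    (hx : x ∉ D.verts) (hx' : x' ∉ D.verts) {g : Site 2} (hg : g ∈ D.verts) (hgF : g ∈ hexFaceVertices (leftFaceDir x k₁))
    (hc : kc D σ x k₁ = kc D σ x' k₂) : ksidx D x k₁ = ksidx D x' k₂ := by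
  have hx'F : x' ∈ hexFaceVertices (leftFaceDir x k₁) := hF ▸ mem_hexFaceVertices_leftFaceDir_self x' k₂
  have hgF' : g ∈ hexFaceVertices (leftFaceDir x' k₂) := hF ▸ hgF
  rw [kc_eq_bdryCol_of_mem σ hx hg hgF, kc_eq_bdryCol_of_mem σ hx' hg hgF'] at hc
  rw [ksidx_eq_of_mem hx hg hgF, ksidx_eq_of_mem hx' hg hgF']
  rcases mem_leftFaceDir_iff.1 hgF with rfl | rfl | rfl
  · exact absurd hg hx
  · rcases mem_leftFaceDir_iff.1 hx'F with rfl | h | rfl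
    · exact absurd rfl hne
    · rw [h] at hx'; exact absurd hg hx'
    · -- `g = x + triDir k₁`, `x' = x + triDir (k₁ + 1)`: corner `k₁ + 2` of `g`
      have e1 : x + triDir k₁ + triDir (k₁ + 2) = x + triDir (k₁ + 1) := add_triDir_add_triDir_add_two x k₁
      have e2 : x + triDir k₁ + triDir (k₁ + 2 + 1) = x := by rw [fin6_add_two_add_one, triDir_add_three, add_neg_cancel_right]
      have := stretchIdx_corner_eq (D := D) (g := x + triDir k₁) (k := k₁ + 2) hg (by rw [e1]; exact hx')
        (by rw [e2]; exact hx) (by rw [e1, e2]; exact hc.symm)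
      rw [e1, e2] at this
      exact this.symm
  · rcases mem_leftFaceDir_iff.1 hx'F with rfl | rfl | h
    · exact absurd rfl hne
    · -- `g = x + triDir (k₁ + 1)`, `x' = x + triDir k₁`: corner `k₁ + 4` of `g`
      have e1 : x + triDir (k₁ + 1) + triDir (k₁ + 4) = x := add_triDir_succ_add_triDir_add_four x k₁
      have e2 : x + triDir (k₁ + 1) + triDir (k₁ + 4 + 1) = x + triDir k₁ := by
        rw [fin6_add_four_add_one, add_triDir_succ_add_triDir_add_five]
      have := stretchIdx_corner_eq (D := D) (g := x + triDir (k₁ + 1)) (k := k₁ + 4) hg (by rw [e1]; exact hx)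
        (by rw [e2]; exact hx') (by rw [e1, e2]; exact hc)
      rwa [e1, e2] at this
    · rw [h] at hx'; exact absurd hg hx'

/-! ### Transfer of the invariants along two kites of the same colour -/

/-- The yellow invariant only depends on the hexagon (inside) and on the stretch (outside). -/
theorem py_congr {p q : Site 2 × Fin 6} (h1 : q.1 = p.1) (h2 : p.1 ∉ D.verts → ksidx D q.1 q.2 = ksidx D p.1 p.2)
    (hp : p ∈ py D σ) : q ∈ py D σ := by
  rcases hp with ⟨hi, hy⟩ | ⟨ho, hs⟩
  · exact Or.inl ⟨h1 ▸ hi, h1 ▸ hy⟩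
  · exact Or.inr ⟨h1 ▸ ho, by rw [h2 ho, hs]⟩

/-- The blue invariant only depends on the hexagon (inside) and on the stretch (outside). -/
theorem pb_congr {p q : Site 2 × Fin 6} (h1 : q.1 = p.1) (h2 : p.1 ∉ D.verts → ksidx D q.1 q.2 = ksidx D p.1 p.2)
    (hp : p ∈ pb D σ) : q ∈ pb D σ := by
  rcases hp with ⟨hi, hy⟩ | ⟨ho, hs⟩
  · exact Or.inl ⟨h1 ▸ hi, h1 ▸ hy⟩
  · exact Or.inr ⟨h1 ▸ ho, by rw [h2 ho, hs]⟩

/-- **Yellow step**: from a yellow kite with the invariant to a yellow kite of an adjacent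
hexagon at the same corner (touching the domain) — the invariant, or a yellow crossing. -/
theorem py_step {x x' : Site 2} {k₁ k₂ : Fin 6} (hadj : triGraph.Adj x x') (hF : leftFaceDir x k₁ = leftFaceDir x' k₂)
    (h₁ : kc D σ x k₁ = true) (h₂ : kc D σ x' k₂ = true) {g : Site 2} (hg : g ∈ D.verts)
    (hgF : g ∈ hexFaceVertices (leftFaceDir x k₁)) (hp : (x, k₁) ∈ py D σ) : (x', k₂) ∈ py D σ ∨ σ ∈ yCross D := by
  have hxF' : x ∈ hexFaceVertices (leftFaceDir x' k₂) := hF ▸ mem_hexFaceVertices_leftFaceDir_self x k₁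
  have hx'F : x' ∈ hexFaceVertices (leftFaceDir x k₁) := hF ▸ mem_hexFaceVertices_leftFaceDir_self x' k₂
  by_cases hx : x ∈ D.verts
  · obtain ⟨du, hdu, hyt, P, hsupp, hdarts⟩ := (hp.resolve_right fun h => h.1 hx).2
    by_cases hx' : x' ∈ D.verts
    · -- extend the chain by the yellow half-edge adjacency `x ∼ x'`
      refine Or.inl (Or.inl ⟨hx', du, hdu, hyt, P.concat hadj, ?_, ?_⟩)
      · intro z hz
        rw [SimpleGraph.Walk.support_concat, List.mem_append, List.mem_singleton] at hz
        rcases hz with hz | rfl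
        · exact hsupp z hz
        · exact ⟨hx', by rw [kc_of_mem σ hx'] at h₂; exact ne_B_of_cornerY h₂⟩
      · intro e he
        rw [SimpleGraph.Walk.darts_concat, List.concat_eq_append, List.mem_append, List.mem_singleton] at he
        rcases he with he | rfl
        · exact hdarts e he
        · exact clYellow_adj_of_kc hadj hF hx hx' h₁ h₂
    · -- `x'` outside: the dart `x → x'` is yellow, in the stretch `0` or `2`
      have hd : (x, x') ∈ triBdryDarts D.verts := mem_triBdryDarts_of hx hx' hadj
      have hs : ksidx D x' k₂ = D.stretchIdx (D.dpos (x, x')) := ksidx_eq_of_mem hx' hx hxF'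
      have hc : TriMarkedDomain.bcolOf (ksidx D x' k₂) = true := by rwa [kc_of_not_mem σ hx'] at h₂
      rcases (TriMarkedDomain.bcolOf_eq_true_iff _).1 hc with h0 | h2
      · exact Or.inl (Or.inr ⟨hx', h0⟩)
      · refine Or.inr ⟨du, (x, x'), P, hdu, ?_, hyt, ?_, hsupp, hdarts⟩
        · have := mem_stretch_stretchIdx hd; rwa [← hs, h2] at this
        · exact ⟨_, mem_hexFaceVertices_leftFaceDir_self x k₁, hx'F, yellowAt_of_kc hx h₁⟩
  · have hs0 : ksidx D x k₁ = 0 := (hp.resolve_left fun h => hx h.1).2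
    by_cases hx' : x' ∈ D.verts
    · -- `x` outside beyond the stretch `0`, `x'` inside: start a new chain at the dart `x' → x`
      have hd : (x', x) ∈ triBdryDarts D.verts := mem_triBdryDarts_of hx' hx hadj.symm
      have hs : ksidx D x k₁ = D.stretchIdx (D.dpos (x', x)) := ksidx_eq_of_mem hx hx' hx'F
      refine Or.inl (Or.inl ⟨hx', (x', x), ?_, ?_, SimpleGraph.Walk.nil, ?_, by simp⟩)
      · have := mem_stretch_stretchIdx hd; rwa [← hs, hs0] at this
      · exact ⟨_, mem_hexFaceVertices_leftFaceDir_self x' k₂, hxF', yellowAt_of_kc hx' h₂⟩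
      · intro z hz
        rw [SimpleGraph.Walk.support_nil, List.mem_singleton] at hz
        subst hz
        exact ⟨hx', by rw [kc_of_mem σ hx'] at h₂; exact ne_B_of_cornerY h₂⟩
    · -- both outside: same stretch
      refine Or.inl (Or.inr ⟨hx', ?_⟩)
      rw [← ksidx_eq_of_outside hF hadj.ne hx hx' hg hgF (by rw [h₁, h₂]), hs0]

/-- **Blue step**: the twin of `py_step` for blue kites, the blue invariant and blue crossings. -/
theorem pb_step {x x' : Site 2} {k₁ k₂ : Fin 6} (hadj : triGraph.Adj x x') (hF : leftFaceDir x k₁ = leftFaceDir x' k₂)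
    (h₁ : kc D σ x k₁ = false) (h₂ : kc D σ x' k₂ = false) {g : Site 2} (hg : g ∈ D.verts)
    (hgF : g ∈ hexFaceVertices (leftFaceDir x k₁)) (hp : (x, k₁) ∈ pb D σ) : (x', k₂) ∈ pb D σ ∨ σ ∈ bCross D := by
  have hxF' : x ∈ hexFaceVertices (leftFaceDir x' k₂) := hF ▸ mem_hexFaceVertices_leftFaceDir_self x k₁
  have hx'F : x' ∈ hexFaceVertices (leftFaceDir x k₁) := hF ▸ mem_hexFaceVertices_leftFaceDir_self x' k₂
  by_cases hx : x ∈ D.verts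
  · obtain ⟨dv, hdv, hbt, P, hsupp, hdarts⟩ := (hp.resolve_right fun h => h.1 hx).2
    by_cases hx' : x' ∈ D.verts
    · refine Or.inl (Or.inl ⟨hx', dv, hdv, hbt, SimpleGraph.Walk.cons hadj.symm P, ?_, ?_⟩)
      · intro z hz
        rw [SimpleGraph.Walk.support_cons, List.mem_cons] at hz
        rcases hz with rfl | hz
        · exact ⟨hx', by rw [kc_of_mem σ hx'] at h₂; exact ne_Y_of_cornerY h₂⟩
        · exact hsupp z hz
      · intro e he
        rw [SimpleGraph.Walk.darts_cons, List.mem_cons] at he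
        rcases he with rfl | he
        · exact clBlue_adj_of_kc hadj.symm hF.symm hx' hx h₂ h₁
        · exact hdarts e he
    · have hd : (x, x') ∈ triBdryDarts D.verts := mem_triBdryDarts_of hx hx' hadj
      have hs : ksidx D x' k₂ = D.stretchIdx (D.dpos (x, x')) := ksidx_eq_of_mem hx' hx hxF'
      have hc : TriMarkedDomain.bcolOf (ksidx D x' k₂) = false := by rwa [kc_of_not_mem σ hx'] at h₂
      rcases (TriMarkedDomain.bcolOf_eq_false_iff _).1 hc with h1 | h3
      · refine Or.inr ⟨(x, x'), dv, P, ?_, hdv, ?_, hbt, hsupp, hdarts⟩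
        · have := mem_stretch_stretchIdx hd; rwa [← hs, h1] at this
        · exact ⟨_, mem_hexFaceVertices_leftFaceDir_self x k₁, hx'F, not_yellowAt_of_kc hx h₁⟩
      · exact Or.inl (Or.inr ⟨hx', h3⟩)
  · have hs3 : ksidx D x k₁ = 3 := (hp.resolve_left fun h => hx h.1).2
    by_cases hx' : x' ∈ D.verts
    · have hd : (x', x) ∈ triBdryDarts D.verts := mem_triBdryDarts_of hx' hx hadj.symm
      have hs : ksidx D x k₁ = D.stretchIdx (D.dpos (x', x)) := ksidx_eq_of_mem hx hx' hx'F
      refine Or.inl (Or.inl ⟨hx', (x', x), ?_, ?_, SimpleGraph.Walk.nil, ?_, by simp⟩)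
      · have := mem_stretch_stretchIdx hd; rwa [← hs, hs3] at this
      · exact ⟨_, mem_hexFaceVertices_leftFaceDir_self x' k₂, hxF', not_yellowAt_of_kc hx' h₂⟩
      · intro z hz
        rw [SimpleGraph.Walk.support_nil, List.mem_singleton] at hz
        subst hz
        exact ⟨hx', by rw [kc_of_mem σ hx'] at h₂; exact ne_Y_of_cornerY h₂⟩
    · refine Or.inl (Or.inr ⟨hx', ?_⟩)
      rw [← ksidx_eq_of_outside hF hadj.ne hx hx' hg hgF (by rw [h₁, h₂]), hs3]

/-! ### One step of the interface preserves the invariant -/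

/-- **The right (yellow) side along one step of the interface.** -/
theorem py_succ {d : Dart} (hd : d ∈ good D σ) (hp : d.R ∈ py D σ) : (succ (kc D σ) d).R ∈ py D σ ∨ σ ∈ yCross D := by
  obtain ⟨⟨hR, hL⟩, ht⟩ := hd
  rcases d with ⟨x, k, κ⟩
  cases κ <;> simp only [Dart.R, Dart.L] at hR hL hp <;> simp only [Dart.touches, decide_eq_true_eq] at ht <;>
    simp only [succ]
  · -- spokeIn: into the corner `k` of `x`, right kite `(y, k + 2)`
    obtain ⟨g, hg, hgF⟩ : ∃ g ∈ D.verts, g ∈ hexFaceVertices (leftFaceDir (x + triDir k) (k + 2)) := by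
      rw [leftFaceDir_add_triDir]
      rcases ht with h | h
      · exact ⟨x, h, mem_hexFaceVertices_leftFaceDir_self x k⟩
      · exact ⟨_, h, add_triDir_mem_leftFaceDir x k⟩
    split_ifs with h1
    · exact Or.inl hp
    · simp only [Dart.R]
      refine py_step (D := D) ?_ ?_ hR (by simpa using h1) hg hgF hp
      · have := triGraph_adj_add_triDir (x + triDir k) (k + 2); rwa [add_triDir_add_triDir_add_two] at this
      · rw [leftFaceDir_add_triDir, leftFaceDir_add_triDir_succ_add_four]
  · -- spokeOut: right kite `(x, k)`
    split_ifs with h1 h2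
    · exact Or.inl hp
    · simp only [Dart.R, triDir_add_three, add_neg_cancel_right, fin6_add_three_add_two]
      exact Or.inl (py_congr (p := (x, k)) rfl (fun hx => ksidx_add_five hx (ht.resolve_left hx)) hp)
    · simp only [Dart.R]
      have h1' : kc D σ x (k + 5) = true := by simpa using h1
      have h2' : kc D σ (x + triDir k) (k + 3) = true := by simpa using h2
      have hp' : (x, k + 5) ∈ py D σ := py_congr (p := (x, k)) rfl (fun hx => ksidx_add_five hx (ht.resolve_left hx)) hp
      obtain ⟨g, hg, hgF⟩ : ∃ g ∈ D.verts, g ∈ hexFaceVertices (leftFaceDir x (k + 5)) := by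
        rcases ht with h | h
        · exact ⟨x, h, mem_hexFaceVertices_leftFaceDir_self x _⟩
        · refine ⟨_, h, ?_⟩
          rw [← leftFaceDir_add_triDir_add_three]; exact mem_hexFaceVertices_leftFaceDir_self _ _
      exact py_step (triGraph_adj_add_triDir x k) (leftFaceDir_add_triDir_add_three x k).symm h1' h2' hg hgF hp'
  · -- splitIn: right kite `(x, k + 5)`, `x` inside
    split_ifs with h1 h2
    · simp only [Dart.R, triDir_add_three, add_neg_cancel_right, fin6_add_three_add_two]
      exact Or.inl hp
    · simp only [Dart.R]
      exact py_step (triGraph_adj_add_triDir x k) (leftFaceDir_add_triDir_add_three x k).symm hR (by simpa using h1)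
        ht (mem_hexFaceVertices_leftFaceDir_self x _) hp
    · simp only [Dart.R]
      have h1' : kc D σ (x + triDir k) (k + 3) = true := by simpa using h1
      -- through the common corner `k + 5` of `x` (both yellow there), then within `y`
      have step := py_step (D := D) (σ := σ) (triGraph_adj_add_triDir x k) (leftFaceDir_add_triDir_add_three x k).symm hR h1'
        ht (mem_hexFaceVertices_leftFaceDir_self x _) hp
      rcases step with step | step
      · refine Or.inl (py_congr (p := (x + triDir k, k + 3)) rfl (fun hy => ?_) step)
        have := ksidx_add_five (D := D) (k := k + 3) hy (by rwa [triDir_add_three, add_neg_cancel_right])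
        rwa [fin6_add_three_add_five] at this
      · exact Or.inr step
  · -- splitOut: within the inside hexagon `x`
    simp only [Dart.R]
    exact Or.inl (py_congr (p := (x, k)) rfl (fun hx => absurd ht hx) hp)

/-- **The left (blue) side along one step of the interface.** -/
theorem pb_succ {d : Dart} (hd : d ∈ good D σ) (hp : d.L ∈ pb D σ) : (succ (kc D σ) d).L ∈ pb D σ ∨ σ ∈ bCross D := by
  obtain ⟨⟨hR, hL⟩, ht⟩ := hd
  rcases d with ⟨x, k, κ⟩
  cases κ <;> simp only [Dart.R, Dart.L] at hR hL hp <;> simp only [Dart.touches, decide_eq_true_eq] at ht <;>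
    simp only [succ]
  · -- spokeIn: left kite `(x, k)`
    obtain ⟨g, hg, hgF⟩ : ∃ g ∈ D.verts, g ∈ hexFaceVertices (leftFaceDir x k) := by
      rcases ht with h | h
      · exact ⟨x, h, mem_hexFaceVertices_leftFaceDir_self x k⟩
      · exact ⟨_, h, add_triDir_mem_leftFaceDir x k⟩
    split_ifs with h1
    · simp only [Dart.L, add_triDir_add_triDir_add_two]
      rw [show k + 2 + 2 = k + 4 by rw [add_assoc]; rfl]
      exact pb_step (triGraph_adj_add_triDir x (k + 1)) (leftFaceDir_add_triDir_succ_add_four x k).symm hL h1 hg hgF hp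
    · simp only [Dart.L, add_triDir_succ_add_triDir_add_four, fin6_add_four_add_two]
      exact Or.inl hp
  · -- spokeOut: left kite `(y, k + 2)`
    have hsame : x + triDir k ∉ D.verts → ksidx D (x + triDir k) (k + 3) = ksidx D (x + triDir k) (k + 2) := fun hy => by
      have := ksidx_add_five (D := D) (k := k + 3) hy (by rw [triDir_add_three, add_neg_cancel_right]; exact ht.resolve_right hy)
      rw [fin6_add_three_add_five] at this; exact this.symm
    split_ifs with h1 h2
    · simp only [Dart.L]
      -- `K(y, k + 3)` is blue too (no diagonal); cross at the common corner `k + 5` of `x`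
      have h3 : kc D σ (x + triDir k) (k + 3) = false := by
        by_contra h3
        rw [Bool.not_eq_false] at h3
        have := kc_midpoint₁ (D := D) (σ := σ) ht hR h1 h3
        rw [hL] at this; exact absurd this (by decide)
      have hp' : (x + triDir k, k + 3) ∈ pb D σ := pb_congr (p := (x + triDir k, k + 2)) rfl hsame hp
      have hadj : triGraph.Adj (x + triDir k) x := by
        have := triGraph_adj_add_triDir (x + triDir k) (k + 3); rwa [triDir_add_three, add_neg_cancel_right] at this
      obtain ⟨g, hg, hgF⟩ : ∃ g ∈ D.verts, g ∈ hexFaceVertices (leftFaceDir (x + triDir k) (k + 3)) := by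
        rw [leftFaceDir_add_triDir_add_three]
        rcases ht with h | h
        · exact ⟨x, h, mem_hexFaceVertices_leftFaceDir_self x _⟩
        · refine ⟨_, h, ?_⟩
          have := add_triDir_succ_mem_leftFaceDir x (k + 5); rwa [fin6_add_five_add_one] at this
      exact pb_step hadj (leftFaceDir_add_triDir_add_three x k) h3 h1 hg hgF hp'
    · simp only [Dart.L]
      exact Or.inl (pb_congr (p := (x + triDir k, k + 2)) rfl hsame hp)
    · simp only [Dart.L, fin6_add_three_add_five]
      exact Or.inl hp
  · -- splitIn: left kite `(x, k)`, `x` inside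
    split_ifs with h1 h2
    · simp only [Dart.L]
      have h4 : kc D σ (x + triDir k) (k + 2) = false := kc_midpoint₂ (Or.inl ht) hL hR h1
      rcases pb_step (triGraph_adj_add_triDir x k) (leftFaceDir_add_triDir x k).symm hL h4 ht
        (mem_hexFaceVertices_leftFaceDir_self x k) hp with h | h
      · refine Or.inl (pb_congr (p := (x + triDir k, k + 2)) rfl (fun hy => ?_) h)
        have := ksidx_add_five (D := D) (k := k + 3) hy (by rw [triDir_add_three, add_neg_cancel_right]; exact ht)
        rw [fin6_add_three_add_five] at this; exact this.symm
      · exact Or.inr h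
    · simp only [Dart.L, fin6_add_three_add_five]
      exact pb_step (triGraph_adj_add_triDir x k) (leftFaceDir_add_triDir x k).symm hL h2 ht
        (mem_hexFaceVertices_leftFaceDir_self x k) hp
    · exact Or.inl hp
  · -- splitOut
    simp only [Dart.L]
    exact Or.inl (pb_congr (p := (x, k + 5)) rfl (fun hx => absurd ht hx) hp)

/-- **One step of the interface preserves the invariant.** -/
theorem inv_succ {d : Dart} (hd : d ∈ good D σ) (hI : d ∈ inv D σ) : succ (kc D σ) d ∈ inv D σ := by
  obtain ⟨hY, hB⟩ := hI
  constructor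
  · rcases hY with hY | hDone
    · rcases py_succ hd hY with h | h
      · exact Or.inl h
      · exact Or.inr (Or.inl h)
    · exact Or.inr hDone
  · rcases hB with hB | hDone
    · rcases pb_succ hd hB with h | h
      · exact Or.inl h
      · exact Or.inr (Or.inr h)
    · exact Or.inr hDone

end Summit.CriticalPhenomena.CardyFormulaZ2.Theorems.BondTriangularCardyLine.Kite
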